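import Mathlib

/-!
# `DivisionGap.PerMultiplesHard` (stmt-ValiantsHypothesis-5068), line `uncharged-face-walk`:
two-band tables under an `ℓ¹` discrepancy budget (stub `stub_twoBandTableW`)

Let `ζ = finRotate n` be the row shift `i ↦ i + 1` of the `n × n` board and `π` any permutation of
`Fin n`.  If the margins `(R, C)` are balanced (`Σ R = Σ C`), column-wise close along the pattern
of `π` (`R (π j) ≤ C j + w j` and `C j ≤ R (π j) + w j`) with total discrepancy `Σ w ≤ W`, and the
columns have offset `W ≤ C j`, then there is a table `M : Fin n × Fin n →₀ ℕ` with row margins `R`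
and column margins `C` all of whose cells `(a, b)` satisfy `π b = a ∨ π b = ζ a`: column `b` uses
only the "pattern" row `π b` and the "backward" row `ζ⁻¹ (π b)`.

Construction.  Put `M (π b, b) := C b - y (π b)`, `M (ζ⁻¹ (π b), b) := y (π b)` and `0` elsewhere
(`table_of_potential`).  The columns are right as soon as `y (π b) ≤ C b`; the row `a` receives
`C (π⁻¹ a) - y a` from its pattern cell and `y (ζ a)` from the backward cell of column
`π⁻¹ (ζ a)`, so the rows are right iff `y (ζ a) - y a = R a - C (π⁻¹ a)` for every `a`.  Along
the cycle `0, 1, …, n - 1` of `ζ` these equations are solved by the partial sums of the defects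
`D a := R a - C (π⁻¹ a)` (the wrap-around closes up because `Σ D = Σ R - Σ C = 0`), shifted by
their minimum to become nonnegative (`exists_potential`).  Closeness gives `|D a| ≤ w (π⁻¹ a)`, so
the shifted partial sums are at most `Σ |D| ≤ Σ w ≤ W ≤ C`, which makes the subtraction
`C b - y (π b)` genuine.  (This is the landed `stub_twoBandTable` with the uniform closeness
replaced by the per-column budget `w` and the offset moved to the columns.)
-/

open scoped BigOperators

set_option linter.dupNamespace false

noncomputable section

namespace Summit.ValiantsHypothesis.ValiantsHypothesis.Theorems.DivisionGap.PerMultiplesHard.TwoBandTableW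

/-! ### The table attached to a potential -/

/-- Given `y` with `y (π b) ≤ C b` satisfying the row equations
`C (π⁻¹ a) - y a + y (ζ a) = R a` (`ζ = finRotate n`), the table with `M (π b, b) = C b - y (π b)`,
`M (ζ⁻¹ (π b), b) = y (π b)` and zero elsewhere has row margins `R`, column margins `C`, and lives
on the cells `(a, b)` with `π b = a ∨ π b = ζ a`. [folklore] -/
theorem table_of_potential {n : ℕ} (π : Equiv.Perm (Fin n)) (R C y : Fin n → ℕ)
    (hy : ∀ b, y (π b) ≤ C b)
    (hrow : ∀ a, C (π.symm a) - y a + y (finRotate n a) = R a) :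
    ∃ M : (Fin n × Fin n) →₀ ℕ,
      (∀ e ∈ M.support, π e.2 = e.1 ∨ π e.2 = finRotate n e.1) ∧
      (∀ i, ∑ j, M (i, j) = R i) ∧ (∀ j, ∑ i, M (i, j) = C j) := by
  refine ⟨Finsupp.equivFunOnFinite.symm fun e =>
      (if π e.2 = e.1 then C e.2 - y e.1 else 0) +
        (if π e.2 = finRotate n e.1 then y (finRotate n e.1) else 0), ?_, ?_, ?_⟩
  · -- the support lies on the pattern cells `(π b, b)` and the backward cells `(ζ⁻¹ (π b), b)`
    intro e he
    simp only [Finsupp.mem_support_iff, Finsupp.coe_equivFunOnFinite_symm] at he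
    by_contra h
    obtain ⟨h1, h2⟩ := not_or.mp h
    refine he ?_
    rw [if_neg h1, if_neg h2]
    rfl
  · -- row `i` carries `(C (π⁻¹ i) - y i) + y (ζ i)`
    intro i
    simp only [Finsupp.coe_equivFunOnFinite_symm, Finset.sum_add_distrib]
    have e1 : ∀ b : Fin n, π b = i ↔ b = π.symm i :=
      fun b => Equiv.apply_eq_iff_eq_symm_apply π
    have e2 : ∀ b : Fin n, π b = finRotate n i ↔ b = π.symm (finRotate n i) :=
      fun b => Equiv.apply_eq_iff_eq_symm_apply π
    simp_rw [e1, e2, Finset.sum_ite_eq', Finset.mem_univ, if_true]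
    exact hrow i
  · -- column `j` receives `C j - y (π j)` from row `π j` and `y (π j)` from row `ζ⁻¹ (π j)`
    intro j
    simp only [Finsupp.coe_equivFunOnFinite_symm, Finset.sum_add_distrib, Finset.sum_ite_eq,
      Finset.mem_univ, if_true]
    have e3 : ∀ a : Fin n, π j = finRotate n a ↔ (finRotate n).symm (π j) = a :=
      fun a => (Equiv.symm_apply_eq (finRotate n)).symm
    simp_rw [e3, Finset.sum_ite_eq, Finset.mem_univ, if_true, Equiv.apply_symm_apply]
    exact Nat.sub_add_cancel (hy j)

/-! ### Potentials along the cycle of `finRotate`, with an `ℓ¹` bound -/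

/-- If `D : Fin (m + 1) → ℤ` sums to zero and `|D a| ≤ w a`, there is a potential `Y` with
`Y (ζ a) - Y a = D a` for every `a` (`ζ = finRotate (m + 1)`) and `0 ≤ Y ≤ Σ w`: the partial
sums of `D` along the cycle `0, 1, …, m` of `ζ`, shifted by their minimum. [folklore] -/
theorem exists_potential (m : ℕ) (D : Fin (m + 1) → ℤ) (hD : ∑ a, D a = 0)
    (w : Fin (m + 1) → ℕ) (hB : ∀ a, -(w a : ℤ) ≤ D a ∧ D a ≤ w a) :
    ∃ Y : Fin (m + 1) → ℤ,
      (∀ a, Y (finRotate (m + 1) a) - Y a = D a) ∧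
      (∀ a, 0 ≤ Y a) ∧ (∀ a, Y a ≤ ∑ b, (w b : ℤ)) := by
  -- extend `D` and `w` by zero to `ℕ` and take partial sums `S k = D 0 + ⋯ + D (k - 1)`,
  -- `A k = w 0 + ⋯ + w (k - 1)`
  set D' : ℕ → ℤ := fun l => if h : l < m + 1 then D ⟨l, h⟩ else 0 with hD'
  set w' : ℕ → ℤ := fun l => if h : l < m + 1 then (w ⟨l, h⟩ : ℤ) else 0 with hw'
  set S : ℕ → ℤ := fun k => ∑ l ∈ Finset.range k, D' l with hS
  set A : ℕ → ℤ := fun k => ∑ l ∈ Finset.range k, w' l with hA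
  have hD'B : ∀ l, -w' l ≤ D' l ∧ D' l ≤ w' l := by
    intro l
    simp only [hD', hw']
    split_ifs with h
    · exact hB _
    · simp
  have hw'0 : ∀ l, 0 ≤ w' l := by
    intro l
    simp only [hw']
    split_ifs
    · positivity
    · exact le_rfl
  have hstepS : ∀ k, S (k + 1) = S k + D' k := fun k => Finset.sum_range_succ _ _
  have hstepA : ∀ k, A (k + 1) = A k + w' k := fun k => Finset.sum_range_succ _ _
  have hA0 : A 0 = 0 := Finset.sum_range_zero _
  have hAmono : Monotone A :=
    monotone_nat_of_le_succ fun k => by rw [hstepA]; linarith [hw'0 k]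
  have hAtop : A (m + 1) = ∑ b, (w b : ℤ) := by
    simp only [hA]
    rw [Finset.sum_range]
    exact Finset.sum_congr rfl fun i _ => by simp only [hw', dif_pos i.isLt, Fin.eta]
  have hSm : S (m + 1) = 0 := by
    simp only [hS]
    rw [Finset.sum_range, ← hD]
    exact Finset.sum_congr rfl fun i _ => by simp only [hD', dif_pos i.isLt, Fin.eta]
  -- increments over `d` steps are bounded by the corresponding increments of `A`
  have hbound : ∀ k d : ℕ,
      S (k + d) - S k ≤ A (k + d) - A k ∧ S k - S (k + d) ≤ A (k + d) - A k := by
    intro k d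
    induction d with
    | zero => simp
    | succ d ih =>
      rw [← add_assoc, hstepS, hstepA]
      obtain ⟨h1, h2⟩ := hD'B (k + d)
      obtain ⟨ih1, ih2⟩ := ih
      exact ⟨by linarith, by linarith⟩
  -- shift by the minimum of the partial sums
  obtain ⟨k₀, hk₀, hmin⟩ := Finset.exists_min_image (Finset.range (m + 1)) S ⟨0, by simp⟩
  rw [Finset.mem_range] at hk₀
  refine ⟨fun a => S a - S k₀, fun a => ?_, fun a => ?_, fun a => ?_⟩
  · -- the step equations, including the wrap-around at the last element of the cycle
    rw [sub_sub_sub_cancel_right]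
    rcases Fin.eq_castSucc_or_eq_last a with ⟨j, rfl⟩ | rfl
    · have hj : finRotate (m + 1) (Fin.castSucc j) = j.succ := finRotate_of_lt j.isLt
      rw [hj, Fin.val_succ, Fin.val_castSucc, hstepS, add_sub_cancel_left]
      simp only [hD', dif_pos (show (j : ℕ) < m + 1 by omega)]
      rfl
    · rw [finRotate_last, Fin.val_zero, Fin.val_last]
      have h0 : S 0 = 0 := Finset.sum_range_zero _
      have hm : S (m + 1) = S m + D' m := hstepS m
      have hDm : D' m = D (Fin.last m) := by
        simp only [hD', dif_pos (lt_add_one m)]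
        rfl
      rw [h0, ← hDm]
      linarith
  · -- nonnegativity
    have := hmin a (Finset.mem_range.mpr a.isLt)
    linarith
  · -- upper bound: the increment of `A` between `a` and `k₀` is at most `A (m + 1) = Σ w`
    rw [← hAtop]
    rcases Nat.lt_or_ge a k₀ with h | h
    · obtain ⟨d, hd⟩ := Nat.exists_eq_add_of_lt h
      have := (hbound a (d + 1)).2
      rw [show (a : ℕ) + (d + 1) = k₀ by omega] at this
      have h1 : A k₀ ≤ A (m + 1) := hAmono hk₀.le
      have h2 : A 0 ≤ A a := hAmono (Nat.zero_le _)
      linarith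
    · obtain ⟨d, hd⟩ := Nat.exists_eq_add_of_le h
      have := (hbound k₀ d).1
      rw [← hd] at this
      have h1 : A a ≤ A (m + 1) := hAmono a.isLt.le
      have h2 : A 0 ≤ A k₀ := hAmono (Nat.zero_le _)
      linarith

/-! ### The two-band table -/

/-- **Two-band (spread) probes exist in every complete class of balanced margins that are close
along a pattern up to an `ℓ¹` budget `W` and have column offset `≥ W`.**  Let `ζ = finRotate n`.
If `Σ R = Σ C`, `R (π j) ≤ C j + w j` and `C j ≤ R (π j) + w j` for all `j`, `Σ w ≤ W` and
`W ≤ C j` for all `j`, then there is a table `M` with row margins `R` and column margins `C` every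
cell `(a, b)` of which satisfies `π b = a ∨ π b = ζ a`. [folklore] -/
theorem stub_twoBandTableW :
    ∀ (n W : ℕ) (π : Equiv.Perm (Fin n)) (R C w : Fin n → ℕ),
      ∑ i, R i = ∑ j, C j →
      (∀ j, R (π j) ≤ C j + w j ∧ C j ≤ R (π j) + w j) → ∑ j, w j ≤ W → (∀ j, W ≤ C j) →
      ∃ M : (Fin n × Fin n) →₀ ℕ,
        (∀ e ∈ M.support, π e.2 = e.1 ∨ π e.2 = finRotate n e.1) ∧
        (∀ i, ∑ j, M (i, j) = R i) ∧ (∀ j, ∑ i, M (i, j) = C j) := by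
  intro n W π R C w hbal hclose hwW hWC
  cases n with
  | zero => exact ⟨0, by simp, fun i => i.elim0, fun j => j.elim0⟩
  | succ m =>
    -- the defects `D a = R a - C (π⁻¹ a)` sum to zero and satisfy `|D a| ≤ w (π⁻¹ a)`
    set D : Fin (m + 1) → ℤ := fun a => (R a : ℤ) - C (π.symm a) with hD
    have hD0 : ∑ a, D a = 0 := by
      have hC : ∑ a, (C (π.symm a) : ℤ) = ∑ j, (C j : ℤ) :=
        Equiv.sum_comp π.symm fun j => (C j : ℤ)
      simp only [hD]
      rw [Finset.sum_sub_distrib, hC, sub_eq_zero]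
      exact_mod_cast hbal
    have hDB : ∀ a, -((w (π.symm a) : ℕ) : ℤ) ≤ D a ∧ D a ≤ ((w (π.symm a) : ℕ) : ℤ) := by
      intro a
      obtain ⟨h1, h2⟩ := hclose (π.symm a)
      rw [Equiv.apply_symm_apply] at h1 h2
      simp only [hD]
      constructor <;> omega
    obtain ⟨Y, hYstep, hY0, hYle⟩ := exists_potential m D hD0 (fun a => w (π.symm a)) hDB
    -- `Y ≤ Σ w ≤ W ≤ C`
    have hsum : ∑ a, ((w (π.symm a) : ℕ) : ℤ) ≤ W := by
      rw [Equiv.sum_comp π.symm fun j => (w j : ℤ)]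
      exact_mod_cast hwW
    have hyC : ∀ b, (Y (π b)).toNat ≤ C b := by
      intro b
      rw [Int.toNat_le]
      exact ((hYle _).trans hsum).trans (by exact_mod_cast hWC b)
    refine table_of_potential π R C (fun a => (Y a).toNat) hyC fun a => ?_
    have h1 : (Y a).toNat ≤ C (π.symm a) := by
      have := hyC (π.symm a)
      rwa [Equiv.apply_symm_apply] at this
    have h := hYstep a
    simp only [hD] at h
    have key : ((C (π.symm a) - (Y a).toNat + (Y (finRotate (m + 1) a)).toNat : ℕ) : ℤ)
        = R a := by
      rw [Nat.cast_add, Nat.cast_sub h1, Int.toNat_of_nonneg (hY0 _), Int.toNat_of_nonneg (hY0 _)]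
      linarith
    exact_mod_cast key

end Summit.ValiantsHypothesis.ValiantsHypothesis.Theorems.DivisionGap.PerMultiplesHard.TwoBandTableW

end
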